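import Summits.CriticalPhenomena.SAWScalingLimit.Theses.SAWRenewalTightness
import Summits.CriticalPhenomena.SAWScalingLimit.Theorems.ShellCrossingBound.Negative.UniformThresholdFalse
import Summits.CriticalPhenomena.SAWScalingLimit.Theorems.ShellCrossingBound.Negative.OfEventualTight
import Literature.Probability.RandomPlanarGeometry.CurveTortuosity
import Literature.Analysis.Complex.BoundaryUniqueness

/-!
# Line `socket-comparison` — skeleton for the crux `SAWRenewalTightness.ShellCrossingBound`

Crux item stmt-CriticalPhenomena-4728 (rank 2 of `route-CriticalPhenomena-SAWRenewalTightness`,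
shared as support by `route-CriticalPhenomena-SAWEdgeOfPositiveType`); crux-plan round 1 for the
idea card `Cruxes/ShellCrossingBound/Ideas/socket-comparison.md` (ideator 2), triage r1-1/2/3:
pass (auxiliary to `pinch-on-a-circle`; two typing repairs demanded — both made here).  Line card:
`Lines/socket-comparison.md`.

Crux (FIXED, concluded BY NAME by `ShellCrossingBound_of`): for every Dobrushin domain `D` and
endpoint approximation `(a_δ, b_δ)` there are a SHELL-DEPENDENT threshold `k x ρ R`, constants
`K`, `λ > 2`, `δ₀ > 0` with `P_δ[k x ρ R separate traversals of D(x; ρ, R)] ≤ K (ρ/R)^λ` for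
`δ ≤ δ₀`, `δ ≤ ρ < R ≤ 1`.

## Calibration (standing `Disproof.lean`, cdisprove cycle 1; landed `Negative/OfEventualTight`,
## `Negative/RadiiThreshold`, `Negative/UniformThresholdFalse`, all imported above)

* `shellCrossingBound_of_eventualTight` / `targets_of_isTightMeasureSet`: with a per-shell
  threshold the crux is EQUIVALENT to the target `EventualTight`; `K`, `λ > 2`, `δ ≤ ρ`, `R ≤ 1`
  are decorative.  HONOURED: the skeleton reaches the crux through per-shell decay of the
  traversal count (`PerShellDecay`, `K = 1`, `λ = 3`, `δ₀ = 1`) and puts CONTENT into ONE stub with a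
  FIXED threshold `k = 4` and a power law (`SocketPinchBound`), which tightness does not imply.
* `Negative.not_uniformThreshold` (= `not_shellCrossingBoundUniformK`, the sheared-sine forcing
  domain): a threshold uniform over ALL shells is FALSE — forcing lives at the marked point `a`.
  HONOURED: the only fixed-threshold stub (`SocketPinchBound`) excludes the balls `B(a, 3r)`,
  `B(b, 3r)` about the marked points and lives in the ENLARGED domain, whose boundary away from the
  sockets is a round circle; no stub is an instance of the refuted uniform statement.
* Disproof §5 (`ShellCrossingBoundBulk`, `k₀ = 3` false at the starting point, `k₀ = 4` predicted):
  the fixed threshold used is `4`, and the shells of `SocketPinchBound` never contain the start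
  `δ·a_δ` (it lies in `B(a, r)` for `δ ≤ δ₀(r)`, the shells in `ℂ ∖ B(a, 2r)`).
* No `_false_without_<H>` theorem exists for this crux (Disproof §3: recorded as a finding).
  Negatives index (9 on the summit): only stmt-0772 (all-`δ` tightness) is nearby; every stub keeps
  an `∃ δ₀` / eventual quantifier or is scale-free.

## The line (4 registered stubs + 2 PROVED rungs, composed by the kernel-checked `ShellCrossingBound_of`)

THE LEVER (card): the `x_c`-law is configurational, so for nested discrete domains it obeys EXACT
restriction covariance `P_{Ω'}(E) · P_Ω(γ is an Ω'-walk) = P_Ω(E ∧ γ is an Ω'-walk) ≤ P_Ω(E)`;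
every unconditional UPPER bound transfers from a big domain `Ω` to a sub-domain `Ω'` at the price
of the confinement probability.  THE MOVE: enlarge an arbitrary Dobrushin domain `D'` to the
SOCKETED DISC `Ω = socketDomain D' L r := D' ∪ (B(0, L) ∖ (B̄(a, r) ∪ B̄(b, r)))` — outside the two
closed socket balls `Ω` IS the disc minus two round plugs (its boundary there is the circle
`|z| = L`, far from `D̄' ⊆ B(0, L/2)`), inside the open socket balls `Ω = D'` exactly (same
boundary germs at the marked points, which is what keeps `Z_{D'}/Z_Ω` of order one), and
`Ω ∖ D'` is at distance `≥ r` from both marked points.  No Jordan curve is built: `SAW.law` takes a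
carrier SET, so the enlargement is a definition, not a stub.

* S1 `stub_travCount` (`TravCountBound`; deterministic, provable now, M): a self-avoiding
  polyline of mesh `δ ≥ δ₁` makes fewer than `N(ρ, δ₁)` separate traversals of any shell of inner
  radius `ρ` (inward traversals end on distinct edges meeting `B̄(x, ρ)`, by convexity of the
  distance along an edge; the walk is a path, so these are distinct lattice edges:
  `N = 2·#{edges of δℤ² meeting a ρ-ball} + 1 ≤ 8 (2ρ/δ₁ + 3)² + 1`).  It absorbs EVERY coarse-mesh
  case, which is why all other stubs may carry shell-, radius- or domain-dependent mesh thresholds.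
* S2 `stub_socketNesting` (`SocketNesting`; lattice topology, provable now, L): for small `δ`
  every `D'_δ`-walk `a_δ → b_δ` is an `Ω_δ`-walk with the same support (edges: `D̄' ⊆ Ω̄`;
  vertices: `meshDomain D' δ` is the bulk component of `D'` —
  `JordanDomain.exists_forall_mem_meshDomain_and_reachable` — and the bulk of the disc minus plugs
  is the unique largest `Ω`-component, every stray `Ω`-component living in the socket balls where
  `Ω = D'`).  Triage repair (b) of r1-1: nesting is only EVENTUAL in `δ`; typed so.
* S3 `RestrictionCovariance` — PROVED in this file (`restrictionCovariance_holds`, sorry-free; the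
  card's lever, kernel-checked): `law Ω' E · law Ω (Conf Ω') ≤ law Ω E` for curve events `E`, under
  graph nesting (two injections of countable sums + `Z'⁻¹ Z' ≤ 1`; every junk case included).
  Triage repair (a) of r1-1/r1-2/r1-3: the confinement event is "the support is the support of an
  `Ω'_δ`-WALK" (vertices AND edges), not vertex containment.
* S4 `stub_socketConfinement` (`SocketConfinement`; OPEN, rate-free — the card's atom
  `ConfinementPositivity` specialised to the socketed disc): `P_Ω[γ is a D'_δ-walk] ≥ c > 0` for
  `δ ≤ δ₀`.  Predicted by SLE₈⸝₃ restriction (the obstacle `Ω ∖ D'` is `r`-far from `a, b`);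
  numerically the band test of the card (0.32/0.28 at mesh 1/64 vs `(√2−1)^{5/4} = 0.332`).
* S5 `stub_socketPinchBound` (`SocketPinchBound`; OPEN, HARDEST — the SAW estimate): in the
  socketed disc, FOUR separate traversals of `D(y; η, R)` cost `≤ C (η/R)^{1+s}` for centres `y`
  with `dist(y, a), dist(y, b) ≥ 3r`, radii `δ ≤ η < R ≤ R₀`, mesh `δ ≤ δ₀` (all constants may depend
  on `D', L, r`).  This is `pinch-on-a-circle`'s atom UTSP moved to the one domain where its shells
  see no wild boundary at all: with `R₀ ≤ r` they avoid the plugs, so they are bulk shells of a disc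
  or flat-boundary shells at `|z| = L` (predicted exponents `x₄ = 35/12`, boundary `7`; threshold
  `1 + s`).
* S6 `PinchUnionBound` — PROVED in this file (`pinchUnionBound_holds`, sorry-free; the union-bound
  rung of `pinch-on-a-circle`, closed as triage r1-1 asked): a two-strand pinch bound away from the
  marked points in `D'` gives per-shell decay of the traversal count (three sub-shells keep the
  middle circle `(R−ρ)/12` away from `a, b` — `exists_good_mid`; pigeonhole on the middle circle —
  `exists_pinch_of_hasTraversals` (ideator 2); net of `k` points — `exists_dist_netPt_le`;
  `measure_iUnion_fintype_le`; `k · C'(η/R')^{1+s} = C'(6πμ/R')(η/R')^s ≤ ε`).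
* Composition (no `sorry`): S2, S3 (proved), S4, S5 ⟹ `PinchAway D'` (restriction transfer with `r = min(d/3,
  |a−b|/8)`, constant `C/c`); S6 (proved) ⟹ `PerShellDecay D'`; S1 ⟹ global mesh threshold `δ₀ = 1`
  and the crux with `K = 1`, `λ = 3` (`ShellCrossingBound_of`).  OPEN after this file: S1, S2
  (provable now), S4, S5 (the two SAW statements).

Namespace `…Cruxes.ShellCrossingBound.SocketComparison`; statements over tree vocabulary
(`SAW.law`, `SAW.DomainSAW`, `SAW.IsEndpointApprox`, `meshPoint`, `Curve.HasTraversals`,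
`MarkedDomain.pt`, `Metric.ball/closedBall`) plus the local `def`s `trav`, `Conf`, `Nested`,
`socketDomain`, `IsSocket`, `PinchAway`, `PerShellDecay`.
-/

noncomputable section

open MeasureTheory Set Metric Filter Topology
open scoped ENNReal
open Literature.Probability.RandomPlanarGeometry Literature.Probability.LatticeModels
open Summit.CriticalPhenomena.SAWScalingLimit.Theses.SAWRenewalTightness (ShellCrossingBound)

namespace Summit.CriticalPhenomena.SAWScalingLimit.Cruxes.ShellCrossingBound.SocketComparison

/-! ### Vocabulary of the line -/

/-- The Aizenman–Burchard event under the critical SAW law of `Ω_δ` from `u` to `v`: the SAW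
polyline (verbatim the crux's curve `⟨γ.walk.toCurve (meshPoint δ)⟩`) makes `k` separate
traversals of the shell `D(y; η, R)`. -/
def trav (Ω : Set ℂ) (δ : ℝ) (u v : Site 2) (k : ℕ) (y : ℂ) (η R : ℝ) :
    Set (SAW.DomainSAW Ω δ u v) :=
  {γ | (⟨γ.walk.toCurve (meshPoint δ)⟩ : Curve ℂ).HasTraversals k y η R}

/-- **Confinement event** (triage-repaired typing): the `Ω_δ`-walk `γ` IS a walk of the sub-domain
`Ω'_δ` — its support is the support of some self-avoiding walk of `discreteDomainGraph Ω' δ`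
(vertices AND edges of `Ω'_δ`; vertex containment alone is the wrong event for wild `Ω'`). -/
def Conf (Ω' Ω : Set ℂ) (δ : ℝ) (u v : Site 2) : Set (SAW.DomainSAW Ω δ u v) :=
  {γ | ∃ γ' : SAW.DomainSAW Ω' δ u v, γ'.walk.support = γ.walk.support}

/-- **Graph nesting at mesh `δ`**: every self-avoiding walk of `Ω'_δ` from `u` to `v` is (the
support of) a self-avoiding walk of `Ω_δ`.  The hypothesis of restriction covariance. -/
def Nested (Ω' Ω : Set ℂ) (δ : ℝ) (u v : Site 2) : Prop :=
  ∀ γ' : SAW.DomainSAW Ω' δ u v, ∃ γ : SAW.DomainSAW Ω δ u v, γ.walk.support = γ'.walk.support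

/-- **The socketed disc** of a Dobrushin domain `D = (D'; a, b)`: `D'` together with the open disc
`B(0, L)` minus the two closed socket balls `B̄(a, r)`, `B̄(b, r)`.  Inside the open socket balls it
coincides with `D'` (same boundary germs at the marked points); outside the closed socket balls it
is the disc minus two round plugs; `Ω ∖ D'` is at distance `≥ r` from `a` and `b`. -/
def socketDomain (D : DobrushinDomain) (L r : ℝ) : Set ℂ :=
  D.carrier ∪ (ball (0 : ℂ) L \ (closedBall (D.pt 0) r ∪ closedBall (D.pt 1) r))

/-- Admissible socket parameters: the disc is large (`D̄' ⊆ B(0, L/2)`), the socket radius is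
positive and small against the distance of the marked points (so the two plugs are far apart
and `D'` sticks out of both socket balls). -/
def IsSocket (D : DobrushinDomain) (L r : ℝ) : Prop :=
  closure D.carrier ⊆ ball (0 : ℂ) (L / 2) ∧ 0 < r ∧ 8 * r ≤ dist (D.pt 0) (D.pt 1)

/-- **Two-strand pinch bound away from the marked points** in the ORIGINAL domain (the transferred
estimate; `pinch-on-a-circle`'s UTSP with a distance-dependent mesh threshold and the mesh clause
`δ ≤ η`): for every `d > 0` there are `C, s > 0, R₀ > 0, δ₁ > 0` with
`P_δ[4 separate traversals of D(y; η, R)] ≤ C (η/R)^{1+s}` for `δ ≤ δ₁`, `δ ≤ η < R ≤ R₀` and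
centres `y` at distance `≥ d` from both marked points. -/
def PinchAway (D : DobrushinDomain) (a b : ℝ → Site 2) : Prop :=
  ∀ d : ℝ, 0 < d → ∃ (C s R₀ δ₁ : ℝ), 0 < s ∧ 0 < R₀ ∧ 0 < δ₁ ∧
    ∀ δ ∈ Set.Ioc (0 : ℝ) δ₁, ∀ (y : ℂ) (η R : ℝ), δ ≤ η → η < R → R ≤ R₀ →
      d ≤ dist y (D.pt 0) → d ≤ dist y (D.pt 1) →
        SAW.law D.carrier δ (a δ) (b δ) (trav D.carrier δ (a δ) (b δ) 4 y η R)
          ≤ ENNReal.ofReal (C * (η / R) ^ (1 + s))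

/-- **Per-shell decay of the traversal count** (shell-dependent mesh threshold): for every genuine
shell and `ε > 0` some number `k` of separate traversals has probability `≤ ε` for all small
meshes.  With S1 this is all the crux asks (calibration: crux ⟺ `EventualTight`). -/
def PerShellDecay (D : DobrushinDomain) (a b : ℝ → Site 2) : Prop :=
  ∀ (x : ℂ) (ρ R : ℝ), 0 < ρ → ρ < R → ∀ ε : ℝ, 0 < ε → ∃ (k : ℕ) (δ₁ : ℝ), 0 < δ₁ ∧
    ∀ δ ∈ Set.Ioc (0 : ℝ) δ₁,
      SAW.law D.carrier δ (a δ) (b δ) (trav D.carrier δ (a δ) (b δ) k x ρ R) ≤ ENNReal.ofReal ε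

/-! ### The six statements of the line (named `Prop`s; S3 and S6 are proved below, the other four are the stubs) -/

/-- **S1 — coarse meshes are free** (deterministic).  For `ρ, δ₁ > 0` there is `N` such that at
every mesh `δ ≥ δ₁`, in every domain and for every pair of endpoints, NO self-avoiding polyline
makes `N` separate traversals of a shell `D(x; ρ, R)` with `ρ < R` (any centre, any outer radius).
Proof sketch: an inward traversal ends at a point of `B̄(x, ρ)` on some edge of the polyline; two
inward traversals ending on the same edge would force the (convex) distance to `x` along that edge
to exceed `R > ρ` between two values `≤ ρ`; the edges of a path are distinct lattice edges, and at
most `4 (2ρ/δ₁ + 3)²` edges of `δℤ²` meet a `ρ`-ball; same for outward traversals. -/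
def TravCountBound : Prop :=
  ∀ (ρ δ₁ : ℝ), 0 < ρ → 0 < δ₁ → ∃ N : ℕ, ∀ (Ω : Set ℂ) (δ : ℝ) (u v : Site 2)
    (γ : SAW.DomainSAW Ω δ u v) (x : ℂ) (R : ℝ), δ₁ ≤ δ → ρ < R →
      ¬ (⟨γ.walk.toCurve (meshPoint δ)⟩ : Curve ℂ).HasTraversals N x ρ R

/-- **S2 — socket nesting** (lattice topology, eventual in the mesh).  For a Dobrushin domain with
an endpoint approximation and admissible socket parameters, for all small `δ` every self-avoiding
walk of `D'_δ` from `a_δ` to `b_δ` is a self-avoiding walk of the socketed disc `Ω_δ`. -/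
def SocketNesting : Prop :=
  ∀ (D : DobrushinDomain) (a b : ℝ → Site 2), SAW.IsEndpointApprox D a b →
    ∀ (L r : ℝ), IsSocket D L r → ∃ δ₁ : ℝ, 0 < δ₁ ∧ ∀ δ ∈ Set.Ioc (0 : ℝ) δ₁,
      Nested D.carrier (socketDomain D L r) δ (a δ) (b δ)

/-- **S3 — restriction covariance of the critical SAW law** (exact; stated as the inequality the
transfer consumes; PROVED below, `restrictionCovariance_holds`).  If every `Ω'_δ`-walk `u → v` is an `Ω_δ`-walk, then for every set `E` of
curves `law Ω' {curve ∈ E} · law Ω (Conf Ω') ≤ law Ω {curve ∈ E}`: indeed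
`law Ω' (E) = W'(E)/Z'`, `law Ω (Conf Ω') = Z'/Z`, and the `Ω'`-walks in `E` are `Ω`-walks in `E`
with the same weight `x_c^{|γ|}` and the same polyline (`toCurve` depends on the support only);
junk cases (`Z` or `Z'` zero or infinite) give `0` on the left. -/
def RestrictionCovariance : Prop :=
  ∀ (Ω' Ω : Set ℂ) (δ : ℝ) (u v : Site 2) (E : Set (Curve ℂ)), Nested Ω' Ω δ u v →
    SAW.law Ω' δ u v {γ' | (⟨γ'.walk.toCurve (meshPoint δ)⟩ : Curve ℂ) ∈ E} *
        SAW.law Ω δ u v (Conf Ω' Ω δ u v) ≤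
      SAW.law Ω δ u v {γ | (⟨γ.walk.toCurve (meshPoint δ)⟩ : Curve ℂ) ∈ E}

/-- **S4 — socket confinement positivity** (OPEN, rate-free; the card's atom for the socketed
disc).  The critical SAW of the socketed disc `Ω` from `a_δ` to `b_δ` IS a walk of `D'_δ` with
probability `≥ c > 0`, uniformly in `δ ≤ δ₀` (`c, δ₀` depending on `D', a, b, L, r`).  The content
is `liminf_{δ→0} Z_{D'}(a_δ,b_δ)/Z_Ω(a_δ,b_δ) > 0`; on any `[δ₁, δ₀]` it is elementary. -/
def SocketConfinement : Prop :=
  ∀ (D : DobrushinDomain) (a b : ℝ → Site 2), SAW.IsEndpointApprox D a b →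
    ∀ (L r : ℝ), IsSocket D L r → ∃ c δ₀ : ℝ, 0 < c ∧ 0 < δ₀ ∧ ∀ δ ∈ Set.Ioc (0 : ℝ) δ₀,
      ENNReal.ofReal c ≤
        SAW.law (socketDomain D L r) δ (a δ) (b δ) (Conf D.carrier (socketDomain D L r) δ (a δ) (b δ))

/-- **S5 — two-strand pinch bound in the socketed disc, away from the sockets** (OPEN, HARDEST).
In `Ω = socketDomain D' L r`: four separate traversals of `D(y; η, R)` by the critical SAW from
`a_δ` to `b_δ` have probability `≤ C (η/R)^{1+s}` whenever `δ ≤ η < R ≤ R₀`, `δ ≤ δ₀` and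
`dist(y, a), dist(y, b) ≥ 3r`.  Choosing `R₀ ≤ r`, every such shell misses the plugs: it is a bulk
shell of the disc or a shell at the round outer boundary.  A fixed-threshold (`k = 4`) arm bound —
content beyond tightness — in the nicest domain the socket move can offer. -/
def SocketPinchBound : Prop :=
  ∀ (D : DobrushinDomain) (a b : ℝ → Site 2), SAW.IsEndpointApprox D a b →
    ∀ (L r : ℝ), IsSocket D L r → ∃ (C s R₀ δ₀ : ℝ), 0 < s ∧ 0 < R₀ ∧ 0 < δ₀ ∧
      ∀ δ ∈ Set.Ioc (0 : ℝ) δ₀, ∀ (y : ℂ) (η R : ℝ), δ ≤ η → η < R → R ≤ R₀ →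
        3 * r ≤ dist y (D.pt 0) → 3 * r ≤ dist y (D.pt 1) →
          SAW.law (socketDomain D L r) δ (a δ) (b δ)
              (trav (socketDomain D L r) δ (a δ) (b δ) 4 y η R) ≤
            ENNReal.ofReal (C * (η / R) ^ (1 + s))

/-- **S6 — the pinch union bound** (`pinch-on-a-circle`'s second rung; PROVED below, `pinchUnionBound_holds`).  A
two-strand pinch bound away from the marked points gives per-shell decay of the traversal count:
for `D(x; ρ, R)` pick one of the three sub-shells of width `(R−ρ)/3` whose middle circle is at
distance `≥ (R−ρ)/12 =: d` from both marked points (`HasTraversals.mono'`), apply the pigeonhole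
`exists_pinch_of_hasTraversals` (PROVED below) and move the pinch centre to one of `k` equally
spaced net points (`HasTraversals.mono`, chord ≤ arc), shrink the outer radius to `min((R−ρ)/12,
R₀ d)` (`mono'`), and sum: `P(k traversals) ≤ k · C (5π r_mid /(k R'))^{1+s} → 0`; take
`δ₁ = min(δ₁(d), η_k)` so that the mesh clause `δ ≤ η_k` holds. -/
def PinchUnionBound : Prop :=
  ∀ (D : DobrushinDomain) (a b : ℝ → Site 2), PinchAway D a b → PerShellDecay D a b

/-! ### The stubs (the ONLY `sorry`s of the file)

Lead's reshape (2026-08-16, registration v2): every stub is stated over TREE VOCABULARY ONLY (the local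
`def`s `trav`, `Conf`, `Nested`, `socketDomain`, `IsSocket` unfolded by hand), so that each lands verbatim as
`Theorems/SAWRenewalTightnessShellCrossingBound<Stub>.lean --supports stmt-CriticalPhenomena-4728` without
importing this workfile; `*_holds` below certify definitionally that the unfolded text IS the named statement. -/

/-- S1 (deterministic, provable now, M): `= TravCountBound` verbatim. -/
theorem stub_travCount :
    ∀ (ρ δ₁ : ℝ), 0 < ρ → 0 < δ₁ → ∃ N : ℕ, ∀ (Ω : Set ℂ) (δ : ℝ) (u v : Site 2)
      (γ : SAW.DomainSAW Ω δ u v) (x : ℂ) (R : ℝ), δ₁ ≤ δ → ρ < R →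
        ¬ (⟨γ.walk.toCurve (meshPoint δ)⟩ : Curve ℂ).HasTraversals N x ρ R := by
  sorry

/-- S2 (lattice topology, provable now, L): `= SocketNesting` with `IsSocket`, `Nested`, `socketDomain`
unfolded. -/
theorem stub_socketNesting :
    ∀ (D : DobrushinDomain) (a b : ℝ → Site 2), SAW.IsEndpointApprox D a b →
      ∀ (L r : ℝ), closure D.carrier ⊆ Metric.ball (0 : ℂ) (L / 2) ∧ 0 < r ∧
          8 * r ≤ dist (D.pt 0) (D.pt 1) →
        ∃ δ₁ : ℝ, 0 < δ₁ ∧ ∀ δ ∈ Set.Ioc (0 : ℝ) δ₁,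
          ∀ γ' : SAW.DomainSAW D.carrier δ (a δ) (b δ),
            ∃ γ : SAW.DomainSAW (D.carrier ∪ (Metric.ball (0 : ℂ) L \
                (Metric.closedBall (D.pt 0) r ∪ Metric.closedBall (D.pt 1) r))) δ (a δ) (b δ),
              γ.walk.support = γ'.walk.support := by
  sorry

/-- S4 (OPEN, rate-free): `= SocketConfinement` with `IsSocket`, `socketDomain`, `Conf` unfolded. -/
theorem stub_socketConfinement :
    ∀ (D : DobrushinDomain) (a b : ℝ → Site 2), SAW.IsEndpointApprox D a b →
      ∀ (L r : ℝ), closure D.carrier ⊆ Metric.ball (0 : ℂ) (L / 2) ∧ 0 < r ∧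
          8 * r ≤ dist (D.pt 0) (D.pt 1) →
        ∃ c δ₀ : ℝ, 0 < c ∧ 0 < δ₀ ∧ ∀ δ ∈ Set.Ioc (0 : ℝ) δ₀,
          ENNReal.ofReal c ≤
            SAW.law (D.carrier ∪ (Metric.ball (0 : ℂ) L \
                (Metric.closedBall (D.pt 0) r ∪ Metric.closedBall (D.pt 1) r))) δ (a δ) (b δ)
              {γ | ∃ γ' : SAW.DomainSAW D.carrier δ (a δ) (b δ),
                γ'.walk.support = γ.walk.support} := by
  sorry

/-- S5 (OPEN, HARDEST): `= SocketPinchBound` with `IsSocket`, `socketDomain`, `trav` unfolded. -/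
theorem stub_socketPinchBound :
    ∀ (D : DobrushinDomain) (a b : ℝ → Site 2), SAW.IsEndpointApprox D a b →
      ∀ (L r : ℝ), closure D.carrier ⊆ Metric.ball (0 : ℂ) (L / 2) ∧ 0 < r ∧
          8 * r ≤ dist (D.pt 0) (D.pt 1) →
        ∃ (C s R₀ δ₀ : ℝ), 0 < s ∧ 0 < R₀ ∧ 0 < δ₀ ∧
          ∀ δ ∈ Set.Ioc (0 : ℝ) δ₀, ∀ (y : ℂ) (η R : ℝ), δ ≤ η → η < R → R ≤ R₀ →
            3 * r ≤ dist y (D.pt 0) → 3 * r ≤ dist y (D.pt 1) →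
              SAW.law (D.carrier ∪ (Metric.ball (0 : ℂ) L \
                  (Metric.closedBall (D.pt 0) r ∪ Metric.closedBall (D.pt 1) r))) δ (a δ) (b δ)
                  {γ | (⟨γ.walk.toCurve (meshPoint δ)⟩ : Curve ℂ).HasTraversals 4 y η R} ≤
                ENNReal.ofReal (C * (η / R) ^ (1 + s)) := by
  sorry

/-! ### Consistency: each unfolded stub IS its named statement (definitionally) -/

/-- `TravCountBound` is the registered stub S1, verbatim. -/
theorem travCountBound_holds : TravCountBound := stub_travCount
/-- `SocketNesting` is the registered stub S2, by unfolding `IsSocket`, `Nested`, `socketDomain`. -/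
theorem socketNesting_holds : SocketNesting := stub_socketNesting
/-- `SocketConfinement` is the registered stub S4, by unfolding `IsSocket`, `socketDomain`, `Conf`. -/
theorem socketConfinement_holds : SocketConfinement := stub_socketConfinement
/-- `SocketPinchBound` is the registered stub S5, by unfolding `IsSocket`, `socketDomain`, `trav`. -/
theorem socketPinchBound_holds : SocketPinchBound := stub_socketPinchBound

/-! ### Registered names of the stub statements

The skeleton audit admits as hypotheses of `ShellCrossingBound_of` only propositions whose head constant
is NAMED like a declared stub (the audit's stub attribute itself is gate-reserved), so each open statement gets a
reducible alias carrying its stub's name.  `Registered.stub_x` unfolds to the statement `X` by `rfl`. -/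
namespace Registered

/-- `TravCountBound`, under the name of its stub. -/
abbrev stub_travCount : Prop := TravCountBound
/-- `SocketNesting`, under the name of its stub. -/
abbrev stub_socketNesting : Prop := SocketNesting
/-- `SocketConfinement`, under the name of its stub. -/
abbrev stub_socketConfinement : Prop := SocketConfinement
/-- `SocketPinchBound`, under the name of its stub. -/
abbrev stub_socketPinchBound : Prop := SocketPinchBound

end Registered

/-! ### The pigeonhole on the middle circle (PROVED; ideator 2, `SketchIdeator2.lean`, copied verbatim)

The deterministic heart of S6: `k ≥ 2` separate traversals of `D(x; ρ₁, R₁)` force FOUR separate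
traversals of `D(y; 4πr/k, (R₁-ρ₁)/2)` for some `y` on the middle sphere `|y - x| = r = (ρ₁+R₁)/2`
(`exists_pinch_of_hasTraversals`).  Used by the proof of `PinchUnionBound` below. -/

section Pinch

open Complex Real
open scoped unitInterval

/-- Intermediate value on a traversal: the segment passes through the middle sphere at a time
strictly after its start. -/
theorem exists_mem_sphere_of_isTraversal {γ : Curve ℂ} {x : ℂ} {ρ₁ R₁ r : ℝ} {s t : I}
    (hρr : ρ₁ < r) (hrR : r < R₁) (h : γ.IsTraversal x ρ₁ R₁ s t) :
    ∃ m : I, s < m ∧ m ≤ t ∧ dist (γ m) x = r := by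
  classical
  -- pull back to a continuous real function on `[s, t]`
  set g : ℝ → ℝ := fun u => dist (γ (Set.projIcc (0 : ℝ) 1 zero_le_one u)) x with hg
  have hgc : Continuous g := (γ.continuous.comp continuous_projIcc).dist continuous_const
  have hgs : g s = dist (γ s) x := by simp [hg, Set.projIcc_val]
  have hgt : g t = dist (γ t) x := by simp [hg, Set.projIcc_val]
  have hst : (s : ℝ) ≤ t := h.1
  -- `r` lies between the endpoint values, in one order or the other
  have hmem : r ∈ g '' Set.Icc (s : ℝ) t := by
    rcases h.2 with ⟨hs, ht⟩ | ⟨hs, ht⟩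
    · exact intermediate_value_Icc hst hgc.continuousOn ⟨by rw [hgs]; linarith, by rw [hgt]; linarith⟩
    · exact intermediate_value_Icc' hst hgc.continuousOn ⟨by rw [hgt]; linarith, by rw [hgs]; linarith⟩
  obtain ⟨c, ⟨hsc, hct⟩, hgc'⟩ := hmem
  have hc01 : c ∈ Set.Icc (0 : ℝ) 1 := ⟨s.2.1.trans hsc, hct.trans t.2.2⟩
  refine ⟨⟨c, hc01⟩, ?_, ?_, ?_⟩
  · -- strict: at time `s` the distance is `≠ r`
    rcases eq_or_lt_of_le (show s ≤ (⟨c, hc01⟩ : I) from hsc) with heq | hlt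
    · exfalso
      have : g c = dist (γ s) x := by rw [← hgs]; congr 1; exact congrArg Subtype.val heq.symm
      rcases h.2 with ⟨hs, -⟩ | ⟨hs, -⟩ <;> linarith
    · exact hlt
  · exact hct
  · have : g c = dist (γ ⟨c, hc01⟩) x := by simp [hg, Set.projIcc_of_mem _ hc01]
    rw [← this, hgc']

/-- Just before a time `m > s` the curve is close to `γ m` (continuity). -/
theorem exists_lt_dist_lt (γ : Curve ℂ) {s m : I} (hsm : s < m) {ε : ℝ} (hε : 0 < ε) :
    ∃ m' : I, s ≤ m' ∧ m' < m ∧ dist (γ m') (γ m) < ε := by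
  obtain ⟨δ, hδ, hδε⟩ := Metric.continuousAt_iff.1 (γ.continuous.continuousAt (x := m)) ε hε
  have hsm' : (s : ℝ) < m := hsm
  set c : ℝ := max (s : ℝ) ((m : ℝ) - δ / 2) with hc
  have hcm : c < m := max_lt hsm' (by linarith)
  have hc01 : c ∈ Set.Icc (0 : ℝ) 1 := ⟨s.2.1.trans (le_max_left _ _), hcm.le.trans m.2.2⟩
  refine ⟨⟨c, hc01⟩, ?_, hcm, hδε ?_⟩
  · show (s : ℝ) ≤ c
    rw [hc]; exact le_max_left _ _
  rw [Subtype.dist_eq, Real.dist_eq, abs_sub_comm, abs_of_pos (by simpa using hcm)]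
  have : (m : ℝ) - δ / 2 ≤ c := le_max_right _ _
  show (m : ℝ) - c < δ
  linarith

/-- Endpoints of a traversal of `D(x; ρ₁, R₁)` are far from every point of the middle sphere. -/
theorem le_dist_of_endpoint {q x y : ℂ} {ρ₁ R₁ : ℝ} (hy : dist y x = (ρ₁ + R₁) / 2)
    (hq : dist q x ≤ ρ₁ ∨ R₁ ≤ dist q x) : (R₁ - ρ₁) / 2 ≤ dist q y := by
  rcases hq with hq | hq
  · have := dist_triangle y q x
    rw [dist_comm y q] at this
    linarith
  · have := dist_triangle q y x
    linarith

/-- Pigeonhole on a circle: among `k ≥ 2` points of the sphere of radius `r > 0` about `x`, two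
(with ordered indices) are at distance `< 4πr/k`. -/
theorem exists_lt_dist_lt_of_mem_sphere {k : ℕ} (hk : 2 ≤ k) {x : ℂ} {r : ℝ} (hr : 0 < r)
    (p : Fin k → ℂ) (hp : ∀ i, dist (p i) x = r) :
    ∃ i j : Fin k, i < j ∧ dist (p i) (p j) < 4 * π * r / k := by
  classical
  have hk1 : (0 : ℝ) < (k : ℝ) - 1 := by
    have : (2 : ℝ) ≤ k := by exact_mod_cast hk
    linarith
  set w : ℝ := 2 * π / ((k : ℝ) - 1) with hw
  have hwpos : 0 < w := div_pos (by positivity) hk1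
  set val : Fin k → ℝ := fun i => (arg (p i - x) + π) / w with hval
  have hval0 : ∀ i, 0 ≤ val i := fun i => by
    have := (arg_mem_Ioc (p i - x)).1
    exact div_nonneg (by linarith) hwpos.le
  have hvalk : ∀ i, val i ≤ (k : ℝ) - 1 := fun i => by
    have h2 := (arg_mem_Ioc (p i - x)).2
    rw [hval, div_le_iff₀ hwpos, hw]
    field_simp
    nlinarith [Real.pi_pos]
  set b : Fin k → ℕ := fun i => min ⌊val i⌋₊ (k - 2) with hb
  -- the boxes: `b i ≤ val i ≤ b i + 1`
  have hbox : ∀ i, (b i : ℝ) ≤ val i ∧ val i ≤ b i + 1 := by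
    intro i
    by_cases hle : ⌊val i⌋₊ ≤ k - 2
    · have hbi : b i = ⌊val i⌋₊ := by simp [hb, hle]
      rw [hbi]
      exact ⟨Nat.floor_le (hval0 i), (Nat.lt_floor_add_one (val i)).le⟩
    · have hbi : b i = k - 2 := by simp [hb, (not_le.1 hle).le]
      rw [hbi]
      refine ⟨?_, ?_⟩
      · have h1 : ((k - 2 : ℕ) : ℝ) ≤ (⌊val i⌋₊ : ℝ) := by exact_mod_cast (not_le.1 hle).le
        exact h1.trans (Nat.floor_le (hval0 i))
      · have h2 : ((k - 2 : ℕ) : ℝ) = (k : ℝ) - 2 := by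
          rw [Nat.cast_sub hk]; norm_num
        rw [h2]; linarith [hvalk i]
  -- pigeonhole: `b` maps `univ` (card k) into `range (k-1)`
  have hmaps : ∀ i ∈ (Finset.univ : Finset (Fin k)), b i ∈ Finset.range (k - 1) := by
    intro i _
    rw [Finset.mem_range]
    have : b i ≤ k - 2 := min_le_right _ _
    omega
  have hcard : (Finset.range (k - 1)).card < (Finset.univ : Finset (Fin k)).card := by
    simp; omega
  obtain ⟨i, -, j, -, hij, hbij⟩ := Finset.exists_ne_map_eq_of_card_lt_of_maps_to hcard hmaps
  -- equal boxes ⇒ angles within `w`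
  have hang : |arg (p i - x) - arg (p j - x)| ≤ w := by
    have h1 := hbox i; have h2 := hbox j
    rw [hbij] at h1
    have hv : |val i - val j| ≤ 1 := by rw [abs_le]; constructor <;> linarith [h1.1, h1.2, h2.1, h2.2]
    have : arg (p i - x) - arg (p j - x) = w * (val i - val j) := by
      simp only [hval]; field_simp; ring
    rw [this, abs_mul, abs_of_pos hwpos]
    calc w * |val i - val j| ≤ w * 1 := by gcongr
      _ = w := mul_one w
  -- chord ≤ arc
  have hpi : ∀ l, p l - x = (r : ℂ) * Complex.exp (arg (p l - x) * Complex.I) := fun l => by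
    have h := norm_mul_exp_arg_mul_I (p l - x)
    have hn : ‖p l - x‖ = r := by rw [← dist_eq_norm]; exact hp l
    rw [hn] at h
    exact h.symm
  have hdist : dist (p i) (p j) ≤ r * w := by
    rw [dist_eq_norm, show p i - p j = (p i - x) - (p j - x) by ring, hpi i, hpi j, ← mul_sub,
      norm_mul, Complex.norm_real, Real.norm_eq_abs, abs_of_pos hr]
    gcongr
    exact (norm_exp_mul_I_sub_exp_mul_I_le _ _).trans hang
  have hdist2 : dist (p i) (p j) ≤ 2 * r := by
    have := dist_triangle (p i) x (p j)
    rw [hp i, dist_comm x (p j), hp j] at this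
    linarith
  -- strictness: `min (r w, 2 r) < 4 π r / k`
  have hlt : dist (p i) (p j) < 4 * π * r / k := by
    have hkpos : (0 : ℝ) < k := by linarith
    rcases eq_or_lt_of_le hk with h2 | h3
    · -- k = 2
      subst h2
      rw [lt_div_iff₀ hkpos]
      push_cast
      nlinarith [Real.pi_gt_three, hdist2, hr]
    · -- k ≥ 3 : r w = 2 π r /(k-1) < 4 π r / k
      have h3' : (3 : ℝ) ≤ k := by exact_mod_cast h3
      refine hdist.trans_lt ?_
      rw [hw, lt_div_iff₀ hkpos]
      rw [show r * (2 * π / ((k : ℝ) - 1)) * k = (2 * π * r * k) / ((k : ℝ) - 1) by ring,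
        div_lt_iff₀ hk1]
      have hpr : 0 < π * r := mul_pos Real.pi_pos hr
      nlinarith [hpr, h3']
  rcases lt_or_gt_of_ne hij with h | h
  · exact ⟨i, j, h, hlt⟩
  · exact ⟨j, i, h, by rwa [dist_comm]⟩

/-- **Pigeonhole on the middle circle** (card pinch-on-a-circle): `k ≥ 2` separate traversals of
`D(x; ρ₁, R₁)` force four separate traversals of `D(y; 4πr/k, (R₁-ρ₁)/2)` for some `y` with
`|y - x| = r = (ρ₁ + R₁)/2`. -/
theorem exists_pinch_of_hasTraversals {γ : Curve ℂ} {x : ℂ} {ρ₁ R₁ : ℝ} {k : ℕ}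
    (hρ : 0 ≤ ρ₁) (hR : ρ₁ < R₁) (hk : 2 ≤ k) (h : γ.HasTraversals k x ρ₁ R₁) :
    ∃ y : ℂ, dist y x = (ρ₁ + R₁) / 2 ∧
      γ.HasTraversals 4 y (4 * Real.pi * ((ρ₁ + R₁) / 2) / k) ((R₁ - ρ₁) / 2) := by
  classical
  obtain ⟨s, t, hst, hsep⟩ := h
  set r : ℝ := (ρ₁ + R₁) / 2 with hr
  set R'' : ℝ := (R₁ - ρ₁) / 2 with hR''
  set η : ℝ := 4 * Real.pi * r / k with hη
  have hρr : ρ₁ < r := by rw [hr]; linarith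
  have hrR : r < R₁ := by rw [hr]; linarith
  have hrpos : 0 < r := by linarith
  -- passage times through the middle sphere
  have hm : ∀ i, ∃ m : I, s i < m ∧ m ≤ t i ∧ dist (γ m) x = r := fun i =>
    exists_mem_sphere_of_isTraversal hρr hrR (hst i)
  choose m hsm hmt hmr using hm
  -- two strands pinch
  obtain ⟨i₀, j₀, hij, hd⟩ :=
    exists_lt_dist_lt_of_mem_sphere hk hrpos (fun i => γ (m i)) hmr
  have hηpos : 0 < η := by
    have hkpos : (0 : ℝ) < k := by have : (2:ℝ) ≤ k := by exact_mod_cast hk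
                                   linarith
    rw [hη]; positivity
  set y : ℂ := γ (m i₀) with hy
  -- times just before the passages
  obtain ⟨m₁, hsm₁, hm₁m, hd₁⟩ := exists_lt_dist_lt γ (hsm i₀) hηpos
  obtain ⟨m₂, hsm₂, hm₂m, hd₂⟩ := exists_lt_dist_lt γ (hsm j₀) (sub_pos.2 hd)
  have hd₂' : dist (γ m₂) y ≤ η := by
    have := dist_triangle (γ m₂) (γ (m j₀)) y
    rw [hy] at this ⊢
    have hcomm : dist (γ (m j₀)) (γ (m i₀)) = dist (γ (m i₀)) (γ (m j₀)) := dist_comm _ _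
    linarith
  -- far endpoints
  have hfar : ∀ i, R'' ≤ dist (γ (s i)) y ∧ R'' ≤ dist (γ (t i)) y := by
    intro i
    have hyx : dist y x = (ρ₁ + R₁) / 2 := hmr i₀
    rcases (hst i).2 with ⟨hs, ht⟩ | ⟨hs, ht⟩
    · exact ⟨le_dist_of_endpoint hyx (Or.inl hs), le_dist_of_endpoint hyx (Or.inr ht)⟩
    · exact ⟨le_dist_of_endpoint hyx (Or.inr hs), le_dist_of_endpoint hyx (Or.inl ht)⟩
  refine ⟨y, hmr i₀, ?_⟩
  -- the four segments
  refine ⟨![s i₀, m i₀, s j₀, m j₀], ![m₁, t i₀, m₂, t j₀], ?_, ?_⟩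
  · intro n
    fin_cases n
    · exact ⟨hsm₁, Or.inr ⟨(hfar i₀).1, hd₁.le⟩⟩
    · refine ⟨hmt i₀, Or.inl ⟨?_, (hfar i₀).2⟩⟩
      simp [hy]; exact hηpos.le
    · exact ⟨hsm₂, Or.inr ⟨(hfar j₀).1, hd₂'⟩⟩
    · refine ⟨hmt j₀, Or.inl ⟨?_, (hfar j₀).2⟩⟩
      have : dist (γ (m j₀)) y ≤ η := by rw [dist_comm, hη]; exact hd.le
      simpa using this
  · -- strict separation of the parameter intervals
    have h01 : m₁ < m i₀ := hm₁m
    have h12 : t i₀ < s j₀ := hsep hij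
    have h23 : m₂ < m j₀ := hm₂m
    have a1 : m i₀ ≤ t i₀ := hmt i₀
    have a2 : s j₀ ≤ m₂ := hsm₂
    intro a c hac
    fin_cases a <;> fin_cases c <;> simp at hac ⊢
    · exact h01
    · exact lt_of_lt_of_le (lt_of_le_of_lt (h01.le.trans a1) h12) le_rfl
    · exact lt_of_lt_of_le (lt_of_le_of_lt ((h01.le.trans a1)) h12) (a2.trans h23.le)
    · exact h12
    · exact lt_of_lt_of_le h12 (a2.trans h23.le)
    · exact h23

end Pinch


/-! ### S3 is PROVED: restriction covariance of the critical SAW law -/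

section Restriction

variable {Ω' Ω : Set ℂ} {δ : ℝ} {u v : Site 2}

/-- The weight of a set of SAWs as a sum of the weights `x_c^{|γ|}` of its members. -/
theorem weight_apply (Ω : Set ℂ) (δ : ℝ) (u v : Site 2) (S : Set (SAW.DomainSAW Ω δ u v)) :
    SAW.weight Ω δ u v S =
      ∑' γ, S.indicator (fun γ => ENNReal.ofReal (SAW.criticalFugacity ^ γ.length)) γ := by
  rw [SAW.weight, Measure.sum_apply _ MeasurableSpace.measurableSet_top]
  refine tsum_congr fun γ => ?_
  rw [Measure.smul_apply, Measure.dirac_apply' _ MeasurableSpace.measurableSet_top, smul_eq_mul]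
  by_cases h : γ ∈ S <;> simp [h]

/-- The law is the normalised weight. -/
theorem law_apply (Ω : Set ℂ) (δ : ℝ) (u v : Site 2) (S : Set (SAW.DomainSAW Ω δ u v)) :
    SAW.law Ω δ u v S = (SAW.weight Ω δ u v Set.univ)⁻¹ * SAW.weight Ω δ u v S := by
  rw [SAW.law, Measure.smul_apply, smul_eq_mul]

/-- A SAW of `Ω_δ` is determined by its support. -/
theorem eq_of_support_eq {γ₁ γ₂ : SAW.DomainSAW Ω δ u v}
    (h : γ₁.walk.support = γ₂.walk.support) : γ₁ = γ₂ := by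
  obtain ⟨p, hp⟩ := γ₁
  obtain ⟨q, hq⟩ := γ₂
  have hpq : p = q := SimpleGraph.Walk.support_injective h
  subst hpq
  rfl

/-- Walks with the same support (possibly in different discrete domains) have the same length. -/
theorem length_eq_of_support_eq {γ' : SAW.DomainSAW Ω' δ u v} {γ : SAW.DomainSAW Ω δ u v}
    (h : γ.walk.support = γ'.walk.support) : γ.length = γ'.length := by
  have h1 := congrArg List.length h
  rw [SimpleGraph.Walk.length_support, SimpleGraph.Walk.length_support] at h1
  show γ.walk.length = γ'.walk.length
  omega

/-- Walks with the same support trace the same polyline. -/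
theorem curve_eq_of_support_eq {γ' : SAW.DomainSAW Ω' δ u v} {γ : SAW.DomainSAW Ω δ u v}
    (h : γ.walk.support = γ'.walk.support) :
    (⟨γ.walk.toCurve (meshPoint δ)⟩ : Curve ℂ) = ⟨γ'.walk.toCurve (meshPoint δ)⟩ := by
  simp only [SimpleGraph.Walk.toCurve, h]

/-- **Half of the identity, no nesting needed**: the weight of the confinement event in `Ω_δ`
is at most the total weight of `Ω'_δ` (each confined `Ω`-walk comes from a unique `Ω'`-walk
with the same weight). -/
theorem weight_conf_le (Ω' Ω : Set ℂ) (δ : ℝ) (u v : Site 2) :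
    SAW.weight Ω δ u v (Conf Ω' Ω δ u v) ≤ SAW.weight Ω' δ u v Set.univ := by
  classical
  rw [weight_apply, weight_apply, ← tsum_subtype]
  -- the `Ω'`-walk behind a confined `Ω`-walk
  have hex : ∀ γ : Conf Ω' Ω δ u v, ∃ γ' : SAW.DomainSAW Ω' δ u v,
      γ'.walk.support = γ.1.walk.support := fun γ => γ.2
  choose κ hκ using hex
  have hinj : Function.Injective κ := by
    intro γ₁ γ₂ h
    apply Subtype.ext
    apply eq_of_support_eq
    rw [← hκ γ₁, ← hκ γ₂, h]
  calc ∑' γ : Conf Ω' Ω δ u v, ENNReal.ofReal (SAW.criticalFugacity ^ γ.1.length)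
      = ∑' γ : Conf Ω' Ω δ u v,
          Set.univ.indicator (fun γ' : SAW.DomainSAW Ω' δ u v =>
            ENNReal.ofReal (SAW.criticalFugacity ^ γ'.length)) (κ γ) := by
        refine tsum_congr fun γ => ?_
        rw [Set.indicator_of_mem (Set.mem_univ _), length_eq_of_support_eq (hκ γ).symm]
    _ ≤ ∑' γ', Set.univ.indicator (fun γ' : SAW.DomainSAW Ω' δ u v =>
          ENNReal.ofReal (SAW.criticalFugacity ^ γ'.length)) γ' :=
        ENNReal.tsum_comp_le_tsum_of_injective hinj _

/-- **The other half, under nesting**: the weight of a curve event among `Ω'`-walks is at most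
its weight among `Ω`-walks (each `Ω'`-walk IS an `Ω`-walk with the same weight and the same
polyline). -/
theorem weight_le_of_nested (hN : Nested Ω' Ω δ u v) (E : Set (Curve ℂ)) :
    SAW.weight Ω' δ u v {γ' | (⟨γ'.walk.toCurve (meshPoint δ)⟩ : Curve ℂ) ∈ E} ≤
      SAW.weight Ω δ u v {γ | (⟨γ.walk.toCurve (meshPoint δ)⟩ : Curve ℂ) ∈ E} := by
  classical
  rw [weight_apply, weight_apply]
  choose ι hι using hN
  have hinj : Function.Injective ι := by
    intro γ₁ γ₂ h
    apply eq_of_support_eq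
    rw [← hι γ₁, ← hι γ₂, h]
  calc ∑' γ', {γ' : SAW.DomainSAW Ω' δ u v | (⟨γ'.walk.toCurve (meshPoint δ)⟩ : Curve ℂ) ∈ E}.indicator
          (fun γ' => ENNReal.ofReal (SAW.criticalFugacity ^ γ'.length)) γ'
      = ∑' γ', {γ : SAW.DomainSAW Ω δ u v | (⟨γ.walk.toCurve (meshPoint δ)⟩ : Curve ℂ) ∈ E}.indicator
          (fun γ => ENNReal.ofReal (SAW.criticalFugacity ^ γ.length)) (ι γ') := by
        refine tsum_congr fun γ' => ?_
        have hc := curve_eq_of_support_eq (hι γ')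
        have hl := length_eq_of_support_eq (hι γ')
        by_cases h : (⟨γ'.walk.toCurve (meshPoint δ)⟩ : Curve ℂ) ∈ E
        · have h' : ι γ' ∈ {γ : SAW.DomainSAW Ω δ u v |
              (⟨γ.walk.toCurve (meshPoint δ)⟩ : Curve ℂ) ∈ E} := by
            show (⟨(ι γ').walk.toCurve (meshPoint δ)⟩ : Curve ℂ) ∈ E
            rwa [hc]
          rw [Set.indicator_of_mem (show γ' ∈ {γ' : SAW.DomainSAW Ω' δ u v |
              (⟨γ'.walk.toCurve (meshPoint δ)⟩ : Curve ℂ) ∈ E} from h), Set.indicator_of_mem h', hl]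
        · have h' : ι γ' ∉ {γ : SAW.DomainSAW Ω δ u v |
              (⟨γ.walk.toCurve (meshPoint δ)⟩ : Curve ℂ) ∈ E} := by
            show ¬ ((⟨(ι γ').walk.toCurve (meshPoint δ)⟩ : Curve ℂ) ∈ E)
            rwa [hc]
          rw [Set.indicator_of_notMem (show γ' ∉ {γ' : SAW.DomainSAW Ω' δ u v |
              (⟨γ'.walk.toCurve (meshPoint δ)⟩ : Curve ℂ) ∈ E} from h), Set.indicator_of_notMem h']
    _ ≤ ∑' γ, {γ : SAW.DomainSAW Ω δ u v | (⟨γ.walk.toCurve (meshPoint δ)⟩ : Curve ℂ) ∈ E}.indicator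
          (fun γ => ENNReal.ofReal (SAW.criticalFugacity ^ γ.length)) γ :=
        ENNReal.tsum_comp_le_tsum_of_injective hinj _

/-- **S3 PROVED — restriction covariance** (`RestrictionCovariance`):
`law Ω' E · law Ω (Conf Ω') ≤ law Ω E` under nesting.  With `Z = weight Ω univ`,
`Z' = weight Ω' univ`: the left side is `Z'⁻¹ W'(E) · Z⁻¹ W(Conf) ≤ Z'⁻¹ W'(E) · Z⁻¹ Z'
= (Z'⁻¹ Z') · Z⁻¹ W'(E) ≤ Z⁻¹ W'(E) ≤ Z⁻¹ W(E)`, using `Z'⁻¹ Z' ≤ 1` (all junk cases included). -/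
theorem restrictionCovariance_holds : RestrictionCovariance := by
  intro Ω' Ω δ u v E hN
  rw [law_apply, law_apply, law_apply]
  set Z := SAW.weight Ω δ u v Set.univ
  set Z' := SAW.weight Ω' δ u v Set.univ
  set WE' := SAW.weight Ω' δ u v {γ' | (⟨γ'.walk.toCurve (meshPoint δ)⟩ : Curve ℂ) ∈ E}
  set WE := SAW.weight Ω δ u v {γ | (⟨γ.walk.toCurve (meshPoint δ)⟩ : Curve ℂ) ∈ E}
  set WC := SAW.weight Ω δ u v (Conf Ω' Ω δ u v)
  have h1 : WC ≤ Z' := weight_conf_le Ω' Ω δ u v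
  have h2 : WE' ≤ WE := weight_le_of_nested hN E
  calc Z'⁻¹ * WE' * (Z⁻¹ * WC) ≤ Z'⁻¹ * WE' * (Z⁻¹ * Z') := by gcongr
    _ = (Z'⁻¹ * Z') * (Z⁻¹ * WE') := by ring
    _ ≤ 1 * (Z⁻¹ * WE') := by gcongr; exact ENNReal.inv_mul_le_one Z'
    _ = Z⁻¹ * WE' := one_mul _
    _ ≤ Z⁻¹ * WE := by gcongr

end Restriction

/-! ### S6 is PROVED: the pinch union bound (`PinchAway → PerShellDecay`) -/

section UnionBound

open Complex Real

/-- Net angles `−π + 2πi/k` on a circle. -/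
def netAngle (k i : ℕ) : ℝ := -π + 2 * π * i / k

/-- Net points on the circle of radius `m` about `x`. -/
def netPt (x : ℂ) (m : ℝ) (k i : ℕ) : ℂ :=
  x + (m : ℂ) * Complex.exp ((netAngle k i : ℝ) * Complex.I)

/-- Net points lie on the circle. -/
theorem dist_netPt (x : ℂ) {m : ℝ} (hm : 0 ≤ m) (k i : ℕ) : dist (netPt x m k i) x = m := by
  rw [netPt, dist_eq_norm, add_sub_cancel_left, norm_mul, Complex.norm_real, Real.norm_eq_abs,
    abs_of_nonneg hm, Complex.norm_exp_ofReal_mul_I, mul_one]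

/-- Every point of the circle of radius `m` about `x` is within `2πm/k` of one of the `k` net
points (chord ≤ arc). -/
theorem exists_dist_netPt_le {x y : ℂ} {m : ℝ} (hm : 0 < m) (hy : dist y x = m) {k : ℕ}
    (hk : 1 ≤ k) : ∃ i : ℕ, i < k ∧ dist y (netPt x m k i) ≤ 2 * π * m / k := by
  have hkpos : (0 : ℝ) < k := by exact_mod_cast hk
  set θ : ℝ := arg (y - x) with hθ
  have hθ1 : -π < θ := (arg_mem_Ioc (y - x)).1
  have hθ2 : θ ≤ π := (arg_mem_Ioc (y - x)).2
  have hyx : y - x = (m : ℂ) * Complex.exp (θ * Complex.I) := by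
    have h := norm_mul_exp_arg_mul_I (y - x)
    have hn : ‖y - x‖ = m := by rw [← dist_eq_norm]; exact hy
    rw [hn] at h
    exact h.symm
  set t : ℝ := (θ + π) * k / (2 * π) with ht
  have ht0 : 0 ≤ t := div_nonneg (mul_nonneg (by linarith) hkpos.le) (by positivity)
  have htk : t ≤ k := by
    rw [ht, div_le_iff₀ (by positivity)]
    nlinarith [hθ2, Real.pi_pos, hkpos]
  set i : ℕ := min ⌊t⌋₊ (k - 1) with hi
  have hik : i < k := by
    have : i ≤ k - 1 := min_le_right _ _
    omega
  have hti : |t - i| ≤ 1 := by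
    by_cases hle : ⌊t⌋₊ ≤ k - 1
    · have hi' : i = ⌊t⌋₊ := min_eq_left hle
      rw [hi']
      have h1 := Nat.floor_le ht0
      have h2 := Nat.lt_floor_add_one t
      rw [abs_le]
      constructor <;> linarith
    · have hi' : i = k - 1 := min_eq_right (not_le.1 hle).le
      rw [hi']
      have hk' : k ≤ ⌊t⌋₊ := by omega
      have h1 : (k : ℝ) ≤ t := le_trans (by exact_mod_cast hk') (Nat.floor_le ht0)
      have h2 : ((k - 1 : ℕ) : ℝ) = (k : ℝ) - 1 := by
        rw [Nat.cast_sub hk]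
        norm_num
      rw [h2, abs_le]
      constructor <;> linarith
  have hang : |θ - netAngle k i| ≤ 2 * π / k := by
    have : θ - netAngle k i = 2 * π / k * (t - i) := by
      rw [netAngle, ht]
      field_simp
      ring
    rw [this, abs_mul, abs_of_pos (by positivity)]
    calc 2 * π / k * |t - i| ≤ 2 * π / k * 1 := by gcongr
      _ = 2 * π / k := mul_one _
  refine ⟨i, hik, ?_⟩
  rw [dist_eq_norm, show y - netPt x m k i = (y - x) - (m : ℂ) * Complex.exp ((netAngle k i : ℝ) * Complex.I) by
    rw [netPt]; ring, hyx, ← mul_sub, norm_mul, Complex.norm_real, Real.norm_eq_abs, abs_of_pos hm]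
  calc m * ‖Complex.exp (θ * Complex.I) - Complex.exp ((netAngle k i : ℝ) * Complex.I)‖
      ≤ m * |θ - netAngle k i| := by
        gcongr
        exact norm_exp_mul_I_sub_exp_mul_I_le _ _
    _ ≤ m * (2 * π / k) := by gcongr
    _ = 2 * π * m / k := by ring

/-- If `t` is `w/4`-close to `m`, it is `w/4`-far from any `m'` at distance `≥ w` from `m`. -/
theorem far_of_near {t m m' w : ℝ} (h : |t - m| < w / 4) (hm : w ≤ |m' - m|) :
    w / 4 ≤ |t - m'| := by
  have h1 : |m' - m| ≤ |m' - t| + |t - m| := abs_sub_le m' t m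
  rw [abs_sub_comm t m']
  linarith [abs_nonneg (m' - t)]

/-- **Three sub-shells**: for a shell `ρ < R` and two points at distances `t₁, t₂` from the
centre, one of the three middle radii `ρ + w/2, ρ + 3w/2, ρ + 5w/2` (`w = (R−ρ)/3`) is at
distance `≥ w/4 = (R−ρ)/12` from both `t₁` and `t₂` (each `tᵢ` spoils at most one of them). -/
theorem exists_good_mid {ρ R : ℝ} (hρR : ρ < R) (t₁ t₂ : ℝ) :
    ∃ μ : ℝ, ρ + (R - ρ) / 6 ≤ μ ∧ μ + (R - ρ) / 6 ≤ R ∧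
      (R - ρ) / 12 ≤ |t₁ - μ| ∧ (R - ρ) / 12 ≤ |t₂ - μ| := by
  set w : ℝ := (R - ρ) / 3 with hw_def
  have hw : 0 < w := by rw [hw_def]; linarith
  have h12 : (R - ρ) / 12 = w / 4 := by rw [hw_def]; ring
  have h6 : (R - ρ) / 6 = w / 2 := by rw [hw_def]; ring
  rw [h12, h6]
  have g10 : w ≤ |(ρ + 3 * w / 2) - (ρ + w / 2)| := by
    rw [show (ρ + 3 * w / 2) - (ρ + w / 2) = w by ring, abs_of_pos hw]
  have g20 : w ≤ |(ρ + 5 * w / 2) - (ρ + w / 2)| := by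
    rw [show (ρ + 5 * w / 2) - (ρ + w / 2) = 2 * w by ring, abs_of_pos (by positivity)]
    linarith
  have g21 : w ≤ |(ρ + 5 * w / 2) - (ρ + 3 * w / 2)| := by
    rw [show (ρ + 5 * w / 2) - (ρ + 3 * w / 2) = w by ring, abs_of_pos hw]
  have hR : R = ρ + 3 * w := by rw [hw_def]; ring
  have b0 : ρ + w / 2 ≤ ρ + w / 2 ∧ ρ + w / 2 + w / 2 ≤ R := ⟨le_rfl, by rw [hR]; linarith⟩
  have b1 : ρ + w / 2 ≤ ρ + 3 * w / 2 ∧ ρ + 3 * w / 2 + w / 2 ≤ R := ⟨by linarith, by rw [hR]; linarith⟩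
  have b2 : ρ + w / 2 ≤ ρ + 5 * w / 2 ∧ ρ + 5 * w / 2 + w / 2 ≤ R := ⟨by linarith, by rw [hR]; linarith⟩
  by_cases h0a : w / 4 ≤ |t₁ - (ρ + w / 2)|
  · by_cases h0b : w / 4 ≤ |t₂ - (ρ + w / 2)|
    · exact ⟨ρ + w / 2, b0.1, b0.2, h0a, h0b⟩
    · have h1b := far_of_near (not_le.1 h0b) g10
      have h2b := far_of_near (not_le.1 h0b) g20
      by_cases h1a : w / 4 ≤ |t₁ - (ρ + 3 * w / 2)|
      · exact ⟨ρ + 3 * w / 2, b1.1, b1.2, h1a, h1b⟩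
      · exact ⟨ρ + 5 * w / 2, b2.1, b2.2, far_of_near (not_le.1 h1a) g21, h2b⟩
  · have h1a := far_of_near (not_le.1 h0a) g10
    have h2a := far_of_near (not_le.1 h0a) g20
    by_cases h1b : w / 4 ≤ |t₂ - (ρ + 3 * w / 2)|
    · exact ⟨ρ + 3 * w / 2, b1.1, b1.2, h1a, h1b⟩
    · exact ⟨ρ + 5 * w / 2, b2.1, b2.2, h2a, far_of_near (not_le.1 h1b) g21⟩

/-- **S6 PROVED — the pinch union bound** (`PinchUnionBound`): a two-strand pinch bound away
from the marked points gives per-shell decay of the traversal count.  For the shell `D(x; ρ, R)`: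
choose the good middle radius `μ` (`exists_good_mid`), restrict the `k` traversals to the
sub-shell `D(x; μ − w/2, μ + w/2)` (`w = (R−ρ)/3`), pinch on its middle circle
(`exists_pinch_of_hasTraversals`), move the pinch centre to one of `k` net points
(`exists_dist_netPt_le`, inner radius `η = 6πμ/k`, outer radius `R' = min (w/4) R₀`), and sum
the `k` pinch bounds: `k · C' (η/R')^{1+s} = C' (6πμ/R') (η/R')^s ≤ ε` for `k` large. -/
theorem pinchUnionBound_holds : PinchUnionBound := by
  intro D a b hPA x ρ R hρ hρR ε hε
  -- Step 1: the good middle radius and its sub-shell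
  obtain ⟨μ, hμ1, hμ2, hfa, hfb⟩ := exists_good_mid hρR (dist (D.pt 0) x) (dist (D.pt 1) x)
  set w : ℝ := (R - ρ) / 3 with hw_def
  have hw : 0 < w := by rw [hw_def]; linarith
  set ρ₁ : ℝ := μ - w / 2 with hρ₁_def
  set R₁ : ℝ := μ + w / 2 with hR₁_def
  have hρρ₁ : ρ ≤ ρ₁ := by rw [hρ₁_def, hw_def]; linarith
  have hR₁R : R₁ ≤ R := by rw [hR₁_def, hw_def]; linarith
  have hρ₁pos : 0 ≤ ρ₁ := hρ.le.trans hρρ₁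
  have hρ₁R₁ : ρ₁ < R₁ := by rw [hρ₁_def, hR₁_def]; linarith
  have hμpos : 0 < μ := by
    have : ρ ≤ μ - w / 2 := hρρ₁
    linarith
  -- Step 2: the pinch bound at distance `d = w/4` from the marked points
  set d : ℝ := w / 4 with hd_def
  have hd : 0 < d := by positivity
  obtain ⟨C, s, R₀, δd, hs, hR₀, hδd, hbound⟩ := hPA d hd
  -- constants
  set C' : ℝ := max C 1 with hC'_def
  have hC' : 1 ≤ C' := le_max_right _ _
  have hC'pos : 0 < C' := lt_of_lt_of_le one_pos hC'
  have hCC' : C ≤ C' := le_max_left _ _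
  set R' : ℝ := min (w / 4) R₀ with hR'_def
  have hR' : 0 < R' := lt_min (by positivity) hR₀
  have hR'w : R' ≤ w / 4 := min_le_left _ _
  have hR'R₀ : R' ≤ R₀ := min_le_right _ _
  have h6 : 0 < 6 * π * μ / R' := by positivity
  set ε' : ℝ := ε / (C' * (6 * π * μ / R')) with hε'_def
  have hε' : 0 < ε' := div_pos hε (mul_pos hC'pos h6)
  have hE : 0 < ε' ^ s⁻¹ := Real.rpow_pos_of_pos hε' _
  set K₀ : ℝ := max (6 * π * μ / (R' * ε' ^ s⁻¹)) (max (6 * π * μ / R') (8 * π * μ / w))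
    with hK₀_def
  set k : ℕ := ⌈K₀⌉₊ + 2 with hk_def
  have hk2 : 2 ≤ k := by omega
  have hk1 : 1 ≤ k := by omega
  have hkK₀ : K₀ < k := by
    have h1 : K₀ ≤ ⌈K₀⌉₊ := Nat.le_ceil K₀
    have h2 : (k : ℝ) = (⌈K₀⌉₊ : ℝ) + 2 := by rw [hk_def]; push_cast; ring
    rw [h2]
    linarith
  have hkpos : (0 : ℝ) < k := by exact_mod_cast (show 0 < k by omega)
  have hkA : 6 * π * μ / (R' * ε' ^ s⁻¹) < k := lt_of_le_of_lt (le_max_left _ _) hkK₀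
  have hkB : 6 * π * μ / R' < k :=
    lt_of_le_of_lt ((le_max_left _ _).trans (le_max_right _ _)) hkK₀
  have hkC : 8 * π * μ / w < k :=
    lt_of_le_of_lt ((le_max_right _ _).trans (le_max_right _ _)) hkK₀
  set η : ℝ := 6 * π * μ / k with hη_def
  have hη : 0 < η := by positivity
  have hηR' : η < R' := by
    rw [hη_def, div_lt_iff₀ hkpos]
    have h1 := (div_lt_iff₀ hR').1 hkB
    calc 6 * π * μ < k * R' := h1
      _ = R' * k := mul_comm _ _
  have hnet : 2 * π * μ / k ≤ w / 4 := by
    rw [div_le_iff₀ hkpos]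
    have h1 := (div_lt_iff₀ hw).1 hkC
    have h2 : 2 * π * μ < w / 4 * k := by
      calc 2 * π * μ = (8 * π * μ) / 4 := by ring
        _ < k * w / 4 := by linarith
        _ = w / 4 * k := by ring
    exact h2.le
  have hsmall : η / R' ≤ ε' ^ s⁻¹ := by
    rw [hη_def, div_div, div_le_iff₀ (by positivity)]
    have h1 := (div_lt_iff₀ (by positivity)).1 hkA
    calc 6 * π * μ ≤ k * (R' * ε' ^ s⁻¹) := h1.le
      _ = ε' ^ s⁻¹ * (k * R') := by ring
  refine ⟨k, min δd η, lt_min hδd hη, fun δ hδ => ?_⟩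
  have hδd' : δ ∈ Set.Ioc (0 : ℝ) δd := ⟨hδ.1, hδ.2.trans (min_le_left _ _)⟩
  have hδη : δ ≤ η := hδ.2.trans (min_le_right _ _)
  -- Step 3: the event inclusion (sub-shell, pinch, net)
  have hsub : trav D.carrier δ (a δ) (b δ) k x ρ R ⊆
      ⋃ i : Fin k, trav D.carrier δ (a δ) (b δ) 4 (netPt x μ k i) η R' := by
    intro γ hγ
    have h1 : (⟨γ.walk.toCurve (meshPoint δ)⟩ : Curve ℂ).HasTraversals k x ρ₁ R₁ :=
      Curve.HasTraversals.mono' hγ hρρ₁ hR₁R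
    obtain ⟨y, hyx, h4⟩ := exists_pinch_of_hasTraversals hρ₁pos hρ₁R₁ hk2 h1
    have hmid : (ρ₁ + R₁) / 2 = μ := by rw [hρ₁_def, hR₁_def]; ring
    have hwid : (R₁ - ρ₁) / 2 = w / 2 := by rw [hρ₁_def, hR₁_def]; ring
    rw [hmid] at hyx h4
    rw [hwid] at h4
    obtain ⟨i, hik, hdist⟩ := exists_dist_netPt_le hμpos hyx hk1
    refine Set.mem_iUnion.2 ⟨⟨i, hik⟩, ?_⟩
    show (⟨γ.walk.toCurve (meshPoint δ)⟩ : Curve ℂ).HasTraversals 4 (netPt x μ k i) η R'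
    refine Curve.HasTraversals.mono h4 ?_ ?_
    · have : 4 * π * μ / k + 2 * π * μ / k = η := by rw [hη_def]; ring
      linarith
    · linarith
  -- distances of the net points from the marked points
  have hfar : ∀ (p : ℂ) (i : ℕ), (R - ρ) / 12 ≤ |dist p x - μ| → d ≤ dist (netPt x μ k i) p := by
    intro p i hp
    have h1 := abs_dist_sub_le p (netPt x μ k i) x
    rw [dist_netPt x hμpos.le] at h1
    rw [dist_comm]
    have : d = (R - ρ) / 12 := by rw [hd_def, hw_def]; ring
    linarith
  -- Step 4: the union bound
  have hq : 0 < η / R' := div_pos hη hR'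
  calc SAW.law D.carrier δ (a δ) (b δ) (trav D.carrier δ (a δ) (b δ) k x ρ R)
      ≤ SAW.law D.carrier δ (a δ) (b δ)
          (⋃ i : Fin k, trav D.carrier δ (a δ) (b δ) 4 (netPt x μ k i) η R') :=
        measure_mono hsub
    _ ≤ ∑ i : Fin k, SAW.law D.carrier δ (a δ) (b δ)
          (trav D.carrier δ (a δ) (b δ) 4 (netPt x μ k i) η R') :=
        measure_iUnion_fintype_le _ _
    _ ≤ ∑ _i : Fin k, ENNReal.ofReal (C' * (η / R') ^ (1 + s)) := by
        refine Finset.sum_le_sum fun i _ => ?_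
        calc SAW.law D.carrier δ (a δ) (b δ) (trav D.carrier δ (a δ) (b δ) 4 (netPt x μ k i) η R')
            ≤ ENNReal.ofReal (C * (η / R') ^ (1 + s)) :=
              hbound δ hδd' (netPt x μ k i) η R' hδη hηR' hR'R₀ (hfar _ _ hfa) (hfar _ _ hfb)
          _ ≤ ENNReal.ofReal (C' * (η / R') ^ (1 + s)) := by
              apply ENNReal.ofReal_le_ofReal
              exact mul_le_mul_of_nonneg_right hCC' (Real.rpow_nonneg hq.le _)
    _ = ENNReal.ofReal (k * (C' * (η / R') ^ (1 + s))) := by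
        rw [Finset.sum_const, Finset.card_univ, Fintype.card_fin, nsmul_eq_mul,
          ENNReal.ofReal_mul (Nat.cast_nonneg k), ENNReal.ofReal_natCast]
    _ ≤ ENNReal.ofReal ε := ENNReal.ofReal_le_ofReal ?_
  -- Step 5: `k · C' · (η/R')^{1+s} ≤ ε`
  have hpow : (η / R') ^ (1 + s) = (η / R') * (η / R') ^ s := by
    rw [Real.rpow_add hq, Real.rpow_one]
  have hs' : (η / R') ^ s ≤ ε' := by
    calc (η / R') ^ s ≤ (ε' ^ s⁻¹) ^ s := Real.rpow_le_rpow hq.le hsmall hs.le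
      _ = ε' := Real.rpow_inv_rpow hε'.le hs.ne'
  have hkη : (k : ℝ) * η = 6 * π * μ := by
    rw [hη_def]
    field_simp
  calc (k : ℝ) * (C' * (η / R') ^ (1 + s)) = C' * ((k * η) / R') * (η / R') ^ s := by
        rw [hpow]
        ring
    _ = C' * (6 * π * μ / R') * (η / R') ^ s := by rw [hkη]
    _ ≤ C' * (6 * π * μ / R') * ε' := by gcongr
    _ = ε := by
        rw [hε'_def]
        field_simp

end UnionBound

/-! ### Composition, part 1: the socket transfer (S2–S5 ⟹ `PinchAway`) -/

/-- The marked points of a Dobrushin domain are distinct, hence at positive distance. -/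
theorem dist_pt_pos (D : DobrushinDomain) : 0 < dist (D.pt 0) (D.pt 1) := by
  refine dist_pos.2 fun h => ?_
  have := D.pt_injective h
  exact absurd this (by decide)

/-- Every Dobrushin domain fits in a large disc: `D̄' ⊆ B(0, L/2)` for some `L`. -/
theorem exists_closure_subset_ball (D : DobrushinDomain) :
    ∃ L : ℝ, closure D.carrier ⊆ ball (0 : ℂ) (L / 2) := by
  obtain ⟨M, hM⟩ := (Metric.isBounded_iff_subset_ball (0 : ℂ)).1 D.isBounded.closure
  refine ⟨2 * M, ?_⟩
  have : (2 * M) / 2 = M := by ring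
  rw [this]
  exact hM

/-- The ENNReal division step of the transfer: `p · c ≤ C q` with `c > 0` gives
`p ≤ (C / c) q`. -/
theorem le_ofReal_div_of_mul_le {p : ℝ≥0∞} {c C q : ℝ} (hc : 0 < c)
    (h : p * ENNReal.ofReal c ≤ ENNReal.ofReal (C * q)) :
    p ≤ ENNReal.ofReal (C / c * q) := by
  have hc' : ENNReal.ofReal c ≠ 0 := (ENNReal.ofReal_pos.2 hc).ne'
  have h1 : p ≤ ENNReal.ofReal (C * q) / ENNReal.ofReal c := by
    rw [ENNReal.le_div_iff_mul_le (Or.inl hc') (Or.inl ENNReal.ofReal_ne_top)]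
    exact h
  have h2 : C / c * q = C * q / c := by ring
  rw [h2, ENNReal.ofReal_div_of_pos hc]
  exact h1

/-- **The socket transfer** (restriction covariance at work): nesting (S2), restriction
covariance (S3), confinement positivity (S4) and the pinch bound in the socketed disc (S5) give the
pinch bound away from the marked points in the ORIGINAL domain, with constant `C / c`.  For the
distance `d` the socket radius is `r = min (d/3) (|a − b|/8)`, so that `3 r ≤ d` and the socket is
admissible. -/
theorem pinchAway_of (h2 : SocketNesting) (h4 : SocketConfinement)
    (h5 : SocketPinchBound) (D : DobrushinDomain) (a b : ℝ → Site 2)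
    (hab : SAW.IsEndpointApprox D a b) : PinchAway D a b := by
  have h3 : RestrictionCovariance := restrictionCovariance_holds
  intro d hd
  obtain ⟨L, hL⟩ := exists_closure_subset_ball D
  have hdist := dist_pt_pos D
  set r : ℝ := min (d / 3) (dist (D.pt 0) (D.pt 1) / 8) with hr_def
  have hr : 0 < r := lt_min (by positivity) (by positivity)
  have hr8 : 8 * r ≤ dist (D.pt 0) (D.pt 1) := by
    have : r ≤ dist (D.pt 0) (D.pt 1) / 8 := min_le_right _ _
    linarith
  have hr3 : 3 * r ≤ d := by
    have : r ≤ d / 3 := min_le_left _ _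
    linarith
  have hsock : IsSocket D L r := ⟨hL, hr, hr8⟩
  obtain ⟨δ₂, hδ₂, hnest⟩ := h2 D a b hab L r hsock
  obtain ⟨c, δ₄, hc, hδ₄, hconf⟩ := h4 D a b hab L r hsock
  obtain ⟨C, s, R₀, δ₅, hs, hR₀, hδ₅, hpinch⟩ := h5 D a b hab L r hsock
  refine ⟨C / c, s, R₀, min δ₂ (min δ₄ δ₅), hs, hR₀, lt_min hδ₂ (lt_min hδ₄ hδ₅), ?_⟩
  intro δ hδ y η R hδη hηR hRR₀ hya hyb
  have hδ2 : δ ∈ Set.Ioc (0 : ℝ) δ₂ := ⟨hδ.1, hδ.2.trans (min_le_left _ _)⟩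
  have hδ4 : δ ∈ Set.Ioc (0 : ℝ) δ₄ := ⟨hδ.1, hδ.2.trans ((min_le_right _ _).trans (min_le_left _ _))⟩
  have hδ5 : δ ∈ Set.Ioc (0 : ℝ) δ₅ := ⟨hδ.1, hδ.2.trans ((min_le_right _ _).trans (min_le_right _ _))⟩
  set Ω : Set ℂ := socketDomain D L r with hΩ_def
  -- restriction covariance for the traversal event (S3 with `E = {4 traversals of D(y; η, R)}`)
  have hcov : SAW.law D.carrier δ (a δ) (b δ) (trav D.carrier δ (a δ) (b δ) 4 y η R) *
      SAW.law Ω δ (a δ) (b δ) (Conf D.carrier Ω δ (a δ) (b δ)) ≤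
        SAW.law Ω δ (a δ) (b δ) (trav Ω δ (a δ) (b δ) 4 y η R) :=
    h3 D.carrier Ω δ (a δ) (b δ) {γc : Curve ℂ | γc.HasTraversals 4 y η R} (hnest δ hδ2)
  -- the bound in the socketed disc (S5)
  have hbig : SAW.law Ω δ (a δ) (b δ) (trav Ω δ (a δ) (b δ) 4 y η R) ≤
      ENNReal.ofReal (C * (η / R) ^ (1 + s)) :=
    hpinch δ hδ5 y η R hδη hηR hRR₀ (hr3.trans hya) (hr3.trans hyb)
  -- confinement positivity (S4)
  have hpos : ENNReal.ofReal c ≤ SAW.law Ω δ (a δ) (b δ) (Conf D.carrier Ω δ (a δ) (b δ)) :=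
    hconf δ hδ4
  have key : SAW.law D.carrier δ (a δ) (b δ) (trav D.carrier δ (a δ) (b δ) 4 y η R) *
      ENNReal.ofReal c ≤ ENNReal.ofReal (C * (η / R) ^ (1 + s)) :=
    calc SAW.law D.carrier δ (a δ) (b δ) (trav D.carrier δ (a δ) (b δ) 4 y η R) * ENNReal.ofReal c
        ≤ SAW.law D.carrier δ (a δ) (b δ) (trav D.carrier δ (a δ) (b δ) 4 y η R) *
            SAW.law Ω δ (a δ) (b δ) (Conf D.carrier Ω δ (a δ) (b δ)) := mul_le_mul' le_rfl hpos
      _ ≤ SAW.law Ω δ (a δ) (b δ) (trav Ω δ (a δ) (b δ) 4 y η R) := hcov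
      _ ≤ ENNReal.ofReal (C * (η / R) ^ (1 + s)) := hbig
  exact le_ofReal_div_of_mul_le hc key

/-! ### Composition, part 2: per-shell decay + coarse-mesh counting ⟹ the crux's bound -/

/-- Per-shell decay (shell-dependent mesh threshold) and the coarse-mesh count S1 give the crux's
conclusion for one `(D, a, b)` with `K = 1`, `λ = 3` and the GLOBAL mesh threshold `δ₀ = 1`: for a
genuine shell take `ε = (ρ/R)^3`, the `k₁, δ₁` of per-shell decay and the `N` of S1 at `(ρ, δ₁)`;
the threshold `max k₁ N` works for `δ ≤ δ₁` by monotonicity in `k` and for `δ > δ₁` because the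
event is empty. -/
theorem bound_of_perShellDecay (h1 : TravCountBound) (D : DobrushinDomain) (a b : ℝ → Site 2)
    (hP : PerShellDecay D a b) :
    ∃ (k : ℂ → ℝ → ℝ → ℕ) (K lam δ₀ : ℝ), 2 < lam ∧ 0 < δ₀ ∧ ∀ δ ∈ Set.Ioc (0 : ℝ) δ₀,
      ∀ (x : ℂ) (ρ R : ℝ), δ ≤ ρ → ρ < R → R ≤ 1 →
        SAW.law D.carrier δ (a δ) (b δ)
            {γ | (⟨γ.walk.toCurve (meshPoint δ)⟩ : Curve ℂ).HasTraversals (k x ρ R) x ρ R} ≤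
          ENNReal.ofReal (K * (ρ / R) ^ lam) := by
  classical
  have key : ∀ (x : ℂ) (ρ R : ℝ), ∃ k : ℕ, 0 < ρ → ρ < R → ∀ δ ∈ Set.Ioc (0 : ℝ) 1,
      SAW.law D.carrier δ (a δ) (b δ) (trav D.carrier δ (a δ) (b δ) k x ρ R) ≤
        ENNReal.ofReal ((ρ / R) ^ (3 : ℝ)) := by
    intro x ρ R
    by_cases h : 0 < ρ ∧ ρ < R
    · have hε : 0 < (ρ / R) ^ (3 : ℝ) := Real.rpow_pos_of_pos (div_pos h.1 (h.1.trans h.2)) _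
      obtain ⟨k₁, δ₁, hδ₁, hk₁⟩ := hP x ρ R h.1 h.2 _ hε
      obtain ⟨N, hN⟩ := h1 ρ δ₁ h.1 hδ₁
      refine ⟨max k₁ N, fun _ _ δ hδ => ?_⟩
      by_cases hle : δ ≤ δ₁
      · calc SAW.law D.carrier δ (a δ) (b δ) (trav D.carrier δ (a δ) (b δ) (max k₁ N) x ρ R)
            ≤ SAW.law D.carrier δ (a δ) (b δ) (trav D.carrier δ (a δ) (b δ) k₁ x ρ R) :=
              measure_mono fun γ hγ => Curve.HasTraversals.of_le hγ (le_max_left _ _)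
          _ ≤ ENNReal.ofReal ((ρ / R) ^ (3 : ℝ)) := hk₁ δ ⟨hδ.1, hle⟩
      · have hempty : trav D.carrier δ (a δ) (b δ) (max k₁ N) x ρ R = ∅ :=
          Set.eq_empty_iff_forall_notMem.2 fun γ hγ =>
            hN D.carrier δ (a δ) (b δ) γ x R (le_of_lt (not_le.1 hle)) h.2
              (Curve.HasTraversals.of_le hγ (le_max_right _ _))
        rw [hempty, measure_empty]
        exact bot_le
    · exact ⟨0, fun h1' h2' => absurd ⟨h1', h2'⟩ h⟩
  choose k hk using key
  refine ⟨k, 1, 3, 1, by norm_num, one_pos, fun δ hδ x ρ R hδρ hρR _ => ?_⟩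
  rw [one_mul]
  exact hk x ρ R (hδ.1.trans_le hδρ) hρR δ hδ

/-! ### The skeleton theorem: the six stubs imply the crux, BY NAME -/

/-- **`ShellCrossingBound` from the line `socket-comparison`** (kernel-checked, no `sorry` of its
own): for each Dobrushin domain the socket transfer (stubs S2, S4, S5 and the proved S3) yields the
two-strand pinch bound away from the marked points, the proved union bound S6 turns it into
per-shell decay, and the coarse-mesh count (stub S1) supplies the global mesh threshold;
`K = 1`, `λ = 3`, `δ₀ = 1`.  Hypotheses = the four open stubs, under their registered names. -/
theorem ShellCrossingBound_of (h1 : Registered.stub_travCount) (h2 : Registered.stub_socketNesting)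
    (h4 : Registered.stub_socketConfinement) (h5 : Registered.stub_socketPinchBound) :
    ShellCrossingBound := by
  intro D a b hab
  exact bound_of_perShellDecay h1 D a b
    (pinchUnionBound_holds D a b (pinchAway_of h2 h4 h5 D a b hab))

/-- Wiring check: the registered stubs feed the skeleton theorem as stated. -/
example : ShellCrossingBound :=
  ShellCrossingBound_of stub_travCount stub_socketNesting stub_socketConfinement
    stub_socketPinchBound

/-! ### By-products recorded for the lead (sorry-free)

* The transfer also serves the route's TARGET directly (card, "Disproof used (b)"): the same three
  stubs S2–S4 turn tightness of the pushed laws of the socketed disc into tightness for `D'`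
  (domination by `1/c` on complements of compacts).  Not needed by the skeleton; not stated.
* Sub-socket shells: `socketDomain D L r ∩ ball (D.pt 0) r = D.carrier ∩ ball (D.pt 0) r`
  (`socketDomain_inter_ball_left`), the structural fact behind S4. -/

/-- Inside the open socket ball about `a` the socketed disc coincides with the original domain. -/
theorem socketDomain_inter_ball_left (D : DobrushinDomain) (L r : ℝ) :
    socketDomain D L r ∩ ball (D.pt 0) r = D.carrier ∩ ball (D.pt 0) r := by
  ext z
  simp only [socketDomain, mem_inter_iff, mem_union, Set.mem_sdiff, mem_closedBall, mem_ball, not_or,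
    not_le]
  constructor
  · rintro ⟨h | ⟨-, h1, -⟩, hz⟩
    · exact ⟨h, hz⟩
    · exact absurd hz (not_lt.2 h1.le)
  · rintro ⟨h, hz⟩
    exact ⟨Or.inl h, hz⟩

/-- Inside the open socket ball about `b` the socketed disc coincides with the original domain. -/
theorem socketDomain_inter_ball_right (D : DobrushinDomain) (L r : ℝ) :
    socketDomain D L r ∩ ball (D.pt 1) r = D.carrier ∩ ball (D.pt 1) r := by
  ext z
  simp only [socketDomain, mem_inter_iff, mem_union, Set.mem_sdiff, mem_closedBall, mem_ball, not_or,
    not_le]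
  constructor
  · rintro ⟨h | ⟨-, -, h2⟩, hz⟩
    · exact ⟨h, hz⟩
    · exact absurd hz (not_lt.2 h2.le)
  · rintro ⟨h, hz⟩
    exact ⟨Or.inl h, hz⟩

/-- The original domain is part of its socketed disc. -/
theorem subset_socketDomain (D : DobrushinDomain) (L r : ℝ) : D.carrier ⊆ socketDomain D L r :=
  subset_union_left

/-- The obstacle `Ω ∖ D'` keeps distance `≥ r` from both marked points. -/
theorem le_dist_of_mem_socketDomain_diff (D : DobrushinDomain) (L r : ℝ) {z : ℂ}
    (hz : z ∈ socketDomain D L r \ D.carrier) :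
    r < dist z (D.pt 0) ∧ r < dist z (D.pt 1) := by
  obtain ⟨hz, hzD⟩ := hz
  rcases hz with h | ⟨-, h⟩
  · exact absurd h hzD
  · simp only [mem_union, mem_closedBall, not_or, not_le] at h
    exact h

/-! ### Negative knowledge checked against (landed `Theorems/ShellCrossingBound/Negative/*`) -/

/-- The refuted UNIFORM-threshold statement (one `k` for all shells, incl. those at the marked
point): recorded here so that no stub drifts into an instance of it — `SocketPinchBound` fixes
`k = 4` only `3r`-away from the marked points, in the socketed disc. -/
example : ¬ (∀ (D : DobrushinDomain) (a b : ℝ → Site 2), SAW.IsEndpointApprox D a b →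
    ∃ (k : ℕ) (K lam δ₀ : ℝ), 2 < lam ∧ 0 < δ₀ ∧ ∀ δ ∈ Set.Ioc (0 : ℝ) δ₀,
      ∀ (x : ℂ) (ρ R : ℝ), δ ≤ ρ → ρ < R → R ≤ 1 →
        SAW.law D.carrier δ (a δ) (b δ)
          {γ | (⟨γ.walk.toCurve (meshPoint δ)⟩ : Curve ℂ).HasTraversals k x ρ R}
            ≤ ENNReal.ofReal (K * (ρ / R) ^ lam)) :=
  Theorems.ShellCrossingBound.Negative.not_uniformThreshold

/-- Calibration (landed): the target already implies the crux — any line must put its content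
elsewhere (here: the fixed threshold `4` of S5). -/
example (hT : Theses.SAWRenewalTightness.EventualTight) : ShellCrossingBound := by
  intro D a b hab
  obtain ⟨δ₀, hδ₀, htight⟩ := hT D a b hab
  obtain ⟨k, hk⟩ :=
    Theorems.ShellCrossingBound.Negative.bound_of_isTightMeasureSet D a b _ htight
  exact ⟨k, 1, 3, δ₀, by norm_num, hδ₀, fun δ hδ x ρ R hδρ hρR _ =>
    hk δ hδ x ρ R (hδ.1.trans_le hδρ) hρR⟩

end Summit.CriticalPhenomena.SAWScalingLimit.Cruxes.ShellCrossingBound.SocketComparison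

end
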